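import Summits.QuantumFields.YangMills.Theorems.BalabanUVNodesN07T47LocalOnto
import Literature.MathematicalPhysics.QuantumFieldTheory.Balaban1983to89.Node00.BgSchemePrOfRecord
import HarnessLib

/-!
# N07 at the record — THE KNIT TOKEN (cov) ∕ `covers` TRANSFERS FROM THE (47)-FREE CHART TO THE (47)-CARRYING CHART: every configuration reached (modulo a relation `R`)
# by `S.chart V A″` with `A″ + 𝔄V` small is reached by `S.chartLin T V A′` — with THE SAME configuration — for `A′ := T_V⁻¹(A″ + 𝔄V) − 𝔄V`; at the record's frame-free
# letters the local inverse exists by ✓`N07T47LocalOnto.exists_ball_subset_T47_image`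

Cell `pub-ymgap`, seat `pub-ymgap-dag-n07-w3` (g28, WIDTH SEAT 3 on N07 [B11]); helper file keyed `--supports stmt-QuantumFields-27238 --as helper` (K0ᴬ road);
count-neutral.  INTENT-23 of the seat.  With files 13–22 the (47)-carrying chart is AT LEAST AS GOOD AS the (47)-free chart on every KNIT token of the K0ᴬ road: (rng)
became a theorem (it was UNINHABITABLE before, LOCATED-g28-2), and (cov) — whatever [15] Thm 1 content the road displays for `S.chart` — transfers verbatim by this file.

## What is here

* §1 (GENERIC: any `BgScheme S`, any slot `T`) ★ `chartLin_eq_chart_of_apply_eq` — `T_V(A′ + 𝔄V) = A″ + 𝔄V ⟹ S.chartLin T V A′ = S.chart V A″` (same exponent; `rfl`-level);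
  ★★ `covers_chartLin_of_covers_chart` — for ANY relation `R` on configurations, any class `Reg`, any averaging `av`: if every `U ∈ Reg` with `Ū^k U = V` is `R`-related to
  some `S.chart V A″` with `A″ ∈ Kc V`, and `T_V` reaches every `A″ + 𝔄V`, `A″ ∈ Kc V` (hypothesis `honto`), then every such `U` is `R`-related to some `S.chartLin T V A′` with
  `T_V(A′ + 𝔄V) − 𝔄V ∈ Kc V`.
* §2 (RECORD, frame-free, any `N`) ★★★ `coversFlat_chartLin_of_covers` — `honto` DISCHARGED by ✓`exists_ball_subset_T47_image` for families with `‖A″ + 𝔄♭V‖ < r` on `dom`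
  (`r` from the local inverse; the Sect. C `Regime` + `Prop4Hyp` + guard displayed): the road's (cov) for def-Y's (47)-free chart of record ⟹ (cov) for the (47)-carrying chart,
  SAME `R` (e.g. `OrbitRel (k+1)`), SAME class.

## Honest labels

Algebra + the local inverse of file 22; the gauge-fixing content of (cov) ([15] Thm 1 ∕ (21)) is whatever the HYPOTHESIS `hcov` carries — nothing of it is proved here; nothing of
Bałaban's estimates; K0ᴬ ⟨27238⟩ NOT closed; N07 NOT discharged; R4 is the conditional finite-𝕋⁴ rung `BalabanLadder.UV` only; finite torus at fixed `ε` — nothing continuum ∕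
OS ∕ Clay.  **The Yang–Mills mass gap is NOT proved by any of this.**  No `sorry`, no `def`, no `instance ∕ notation`; standard axioms.
[cite: Balaban1985Variational, Thm 1 p.279, (15) p.280, (20)–(21) p.281, (47) p.285, Prop. 3 p.289, Prop. 7 p.299]
-/

set_option autoImplicit false

noncomputable section

open scoped Matrix Matrix.Norms.L2Operator InnerProductSpace Topology

namespace Summit.QuantumFields.YangMills.Theorems.N07ChartLinCoversTransfer

open Literature.MathematicalPhysics.QuantumFieldTheory.Balaban1983to89
open Literature.MathematicalPhysics.QuantumFieldTheory.Balaban1983to89.T4Continuum (T4Family)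
open Literature.MathematicalPhysics.QuantumFieldTheory.Balaban1983to89.Node00
open B11Eq103H1Complex (SiteL2K BondL2K)
open B11Eq174Chart (Regime)
open B11Prop6Scheme (Prop4Hyp)
open B11Eq90V0GroupComposed (T47)
open Summit.QuantumFields.YangMills.Theorems.N07T47LocalOnto (exists_ball_subset_T47_image)

/-! ## §1  Generic: any scheme, any slot -/

section Generic

variable {F : T4Family} {N : ℕ} [NeZero N] {𝒴 𝒵 : Type} [NormedAddCommGroup 𝒴] [NormedSpace ℂ 𝒴] [NormedAddCommGroup 𝒵] [NormedSpace ℂ 𝒵] {K k : ℕ}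
  (S : BgScheme F N 𝒴 𝒵 K k) (T : GaugeField (F.P K) k (SU N) → 𝒴 → 𝒴)

omit [NeZero N] in
/-- ★ **SAME EXPONENT, SAME CONFIGURATION**: if `T_V(A′ + 𝔄V) = A″ + 𝔄V` then `S.chartLin T V A′ = S.chart V A″`. [cite: Balaban1985Variational, (15) p.280, (47) p.285] -/
theorem chartLin_eq_chart_of_apply_eq {V : GaugeField (F.P K) k (SU N)} {A' A'' : 𝒴} (h : T V (A' + S.𝔄 V) = A'' + S.𝔄 V) :
    S.chartLin T V A' = S.chart V A'' := by
  funext b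
  rw [BgScheme.chartLin_apply, BgScheme.expoLinAt_apply, h, BgScheme.chart_apply]
  rfl

/-- ★★ **(cov) TRANSFERS ALONG A SLOT THAT REACHES THE FAMILY**: for any relation `R`, class `Reg`, averaging `av`: if every `U ∈ Reg` with `Ū^k U = V` is `R`-related to some
`S.chart V A″`, `A″ ∈ Kc V`, and `T_V` reaches every `A″ + 𝔄V` with `A″ ∈ Kc V`, then every such `U` is `R`-related to some `S.chartLin T V A′` with `T_V(A′ + 𝔄V) − 𝔄V ∈ Kc V`.
[cite: Balaban1985Variational, Thm 1 p.279, (47) p.285, Prop. 7 p.299] -/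
theorem covers_chartLin_of_covers_chart (R : GaugeField (F.P K) 0 (SU N) → GaugeField (F.P K) 0 (SU N) → Prop) (Reg : Set (GaugeField (F.P K) 0 (SU N)))
    (av : ∀ j, Averaging (F.P K) j (SU N)) (Kc : GaugeField (F.P K) k (SU N) → Set 𝒴)
    (hcov : ∀ V ∈ S.dom, ∀ U : GaugeField (F.P K) 0 (SU N), U ∈ Reg → Averaging.iter av k U = V → ∃ A'' ∈ Kc V, R (S.chart V A'') U)
    (honto : ∀ V ∈ S.dom, ∀ A'' ∈ Kc V, ∃ A₁ : 𝒴, T V A₁ = A'' + S.𝔄 V) :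
    ∀ V ∈ S.dom, ∀ U : GaugeField (F.P K) 0 (SU N), U ∈ Reg → Averaging.iter av k U = V →
      ∃ A' : 𝒴, T V (A' + S.𝔄 V) - S.𝔄 V ∈ Kc V ∧ R (S.chartLin T V A') U := by
  intro V hV U hU hiter
  obtain ⟨A'', hA'', hR⟩ := hcov V hV U hU hiter
  obtain ⟨A₁, hA₁⟩ := honto V hV A'' hA''
  refine ⟨A₁ - S.𝔄 V, ?_, ?_⟩
  · rw [sub_add_cancel, hA₁, add_sub_cancel_right]; exact hA''
  · have h : T V (A₁ - S.𝔄 V + S.𝔄 V) = A'' + S.𝔄 V := by rw [sub_add_cancel, hA₁]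
    rw [chartLin_eq_chart_of_apply_eq S T h]; exact hR

end Generic

/-! ## §2  At the record, frame-free: `honto` discharged by the local inverse of `T47` -/

section Record

variable (F : T4Family) (N : ℕ) [NeZero N] (K : ℕ) (k : ℕ) (Ω : ℕ → Set (Site (F.P K) 0)) (U₀ : GaugeField (F.P K) 0 (SU N))
  [Fact (0 < (F.L : ℝ))] [Fact (0 < (F.P K).eta k)] [Fact (0 < c0Rec F K k)] [Fact (∀ c, 0 < wBRec F K k c)]
  (levB : PBond (F.P K) k → ℕ) (a : ℝ)
  (hposb : ∀ x, x ≠ 0 → 0 < RCLike.re ⟪x, laplaceAOfRecord F N k U₀ (QOfRecord F N k U₀) (QflatOfRecord F N k) a x⟫_ℂ)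
  (hQ : Function.Surjective (QOfRecord F N k U₀))
  (Gp : SiteL2K ℂ (F.P K).d (fun _ => (F.P K).sitesPerDir 0) (c0Rec F K k) (WRec N) →ₗ[ℂ]
    SiteL2K ℂ (F.P K).d (fun _ => (F.P K).sitesPerDir 0) (c0Rec F K k) (WRec N))
  (Δ2 : BondL2K ℂ (F.P K).d (fun _ => (F.P K).sitesPerDir 0) (c0Rec F K k) (WRec N) →ₗ[ℂ]
    BondL2K ℂ (F.P K).d (fun _ => (F.P K).sitesPerDir 0) (c0Rec F K k) (WRec N))
  (hposπ : ∀ x, x ≠ 0 → 0 < RCLike.re ⟪x, laplaceAOfRecordAt F N k U₀ (hessOpOfRecord128 F N k U₀ Gp (QflatOfRecord F N k) Δ2)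
    (QOfRecord F N k U₀) (QflatOfRecord F N k) a x⟫_ℂ)

/-- ★★★ **(cov) FOR THE (47)-FREE CHART OF RECORD ⟹ (cov) FOR THE (47)-CARRYING CHART** (frame-free; any relation `R`, any class, any family with `‖A″ + 𝔄♭V‖ < r` on `dom`, where
`r > 0` is the local-inverse radius of `T47` at a guarded background under the Sect. C `Regime` + `Prop4Hyp`; the new family is `{A′ | T47(A′ + 𝔄♭V) − 𝔄♭V ∈ Kc V}` and the chart
points are THE SAME configurations). [cite: Balaban1985Variational, Thm 1 p.279, (15) p.280, (47) p.285, Prop. 3 p.289, Prop. 7 p.299] -/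
theorem coversFlat_chartLin_of_covers (hU₀ : SmallBelow (avOfRecord F N K) k U₀) {b C₂ c₄ aC εC : ℝ}
    (RC : Regime (H1OfRecordAtBgFlat F N K k Ω U₀ levB a hposb hQ) (0 : Space115Lit F N K k Ω U₀ →L[ℂ] Space115Lit F N K k Ω U₀)
      (CslOfRecord F N K k Ω U₀ levB) b 0 C₂ c₄ 0 aC εC)
    (hC : Prop4Hyp (CslOfRecord F N K k Ω U₀ levB) C₂ c₄) (haC : 0 < aC) {ρ : ℝ} (hρ : 0 < ρ) :
    ∃ r : ℝ, 0 < r ∧ ∀ (dom : Set (GaugeField (F.P K) k (SU N))) (B₀ C₄ a₃ j a𝔄 ε₄ : ℝ)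
      (R : GaugeField (F.P K) 0 (SU N) → GaugeField (F.P K) 0 (SU N) → Prop) (Reg : Set (GaugeField (F.P K) 0 (SU N)))
      (Kc : GaugeField (F.P K) k (SU N) → Set (Space115Lit F N K k Ω U₀)),
      (∀ V ∈ dom, ∀ A'' ∈ Kc V, ‖A'' + frakAOfRecordAtBg128 F N K k Ω U₀ levB Gp Δ2 a hposπ hQ V‖ < r) →
      (∀ V ∈ dom, ∀ U : GaugeField (F.P K) 0 (SU N), U ∈ Reg → Averaging.iter (avOfRecord F N K) k U = V →
        ∃ A'' ∈ Kc V, R ((bgSchemeOfRecord F N K k Ω U₀ dom levB Gp Δ2 a hposπ hposb hQ εC B₀ C₄ a₃ j a𝔄 ε₄).chart V A'') U) →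
      ∀ V ∈ dom, ∀ U : GaugeField (F.P K) 0 (SU N), U ∈ Reg → Averaging.iter (avOfRecord F N K) k U = V →
        ∃ A' : Space115Lit F N K k Ω U₀,
          T47 (H1OfRecordAtBgFlat F N K k Ω U₀ levB a hposb hQ) (CslOfRecord F N K k Ω U₀ levB) εC
              (A' + frakAOfRecordAtBg128 F N K k Ω U₀ levB Gp Δ2 a hposπ hQ V) - frakAOfRecordAtBg128 F N K k Ω U₀ levB Gp Δ2 a hposπ hQ V ∈ Kc V ∧
            ‖A' + frakAOfRecordAtBg128 F N K k Ω U₀ levB Gp Δ2 a hposπ hQ V‖ < ρ ∧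
            R ((bgSchemeOfRecord F N K k Ω U₀ dom levB Gp Δ2 a hposπ hposb hQ εC B₀ C₄ a₃ j a𝔄 ε₄).chartLin
              (fun _ => T47 (H1OfRecordAtBgFlat F N K k Ω U₀ levB a hposb hQ) (CslOfRecord F N K k Ω U₀ levB) εC) V A') U := by
  obtain ⟨r, hr, honto⟩ := exists_ball_subset_T47_image F N K k Ω U₀ levB a hposb hQ RC hU₀ hC haC hρ
  refine ⟨r, hr, fun dom B₀ C₄ a₃ j a𝔄 ε₄ R Reg Kc hsmall hcov V hV U hU hiter => ?_⟩
  obtain ⟨A'', hA'', hR⟩ := hcov V hV U hU hiter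
  obtain ⟨A₁, hA₁ρ, hA₁⟩ := honto _ (hsmall V hV A'' hA'')
  have h𝔄 : (bgSchemeOfRecord F N K k Ω U₀ dom levB Gp Δ2 a hposπ hposb hQ εC B₀ C₄ a₃ j a𝔄 ε₄).𝔄 V =
      frakAOfRecordAtBg128 F N K k Ω U₀ levB Gp Δ2 a hposπ hQ V := rfl
  refine ⟨A₁ - frakAOfRecordAtBg128 F N K k Ω U₀ levB Gp Δ2 a hposπ hQ V, ?_, ?_, ?_⟩
  · rw [sub_add_cancel, hA₁, add_sub_cancel_right]; exact hA''
  · rw [sub_add_cancel]; exact hA₁ρ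
  · have h : (fun _ : GaugeField (F.P K) k (SU N) => T47 (H1OfRecordAtBgFlat F N K k Ω U₀ levB a hposb hQ) (CslOfRecord F N K k Ω U₀ levB) εC) V
        (A₁ - frakAOfRecordAtBg128 F N K k Ω U₀ levB Gp Δ2 a hposπ hQ V +
          (bgSchemeOfRecord F N K k Ω U₀ dom levB Gp Δ2 a hposπ hposb hQ εC B₀ C₄ a₃ j a𝔄 ε₄).𝔄 V) =
        A'' + (bgSchemeOfRecord F N K k Ω U₀ dom levB Gp Δ2 a hposπ hposb hQ εC B₀ C₄ a₃ j a𝔄 ε₄).𝔄 V := by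
      show T47 (H1OfRecordAtBgFlat F N K k Ω U₀ levB a hposb hQ) (CslOfRecord F N K k Ω U₀ levB) εC
          (A₁ - frakAOfRecordAtBg128 F N K k Ω U₀ levB Gp Δ2 a hposπ hQ V +
            (bgSchemeOfRecord F N K k Ω U₀ dom levB Gp Δ2 a hposπ hposb hQ εC B₀ C₄ a₃ j a𝔄 ε₄).𝔄 V) =
          A'' + (bgSchemeOfRecord F N K k Ω U₀ dom levB Gp Δ2 a hposπ hposb hQ εC B₀ C₄ a₃ j a𝔄 ε₄).𝔄 V
      rw [h𝔄, sub_add_cancel, hA₁]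
    rw [chartLin_eq_chart_of_apply_eq _ _ h]; exact hR

end Record

end Summit.QuantumFields.YangMills.Theorems.N07ChartLinCoversTransfer

end
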